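import Summits.ResolutionOfSingularities.ResolutionOfSingularities.Theorems.EquisingularLiftEquisingularLiftResolveOnePointDimOne
import Summits.ResolutionOfSingularities.ResolutionOfSingularities.Theorems.EquisingularLiftEquisingularLiftCurveCase
import HarnessLib

/-!
# [OURS · L1 W4.5(b) · EL♮] the SECTION STEP with the E1 clause — helpers for `stub_elnat_le_two`
# (crux `EquisingularLiftNat` = stmt-ResolutionOfSingularities-20038, line `sections` = `SkeletonELnat-v1` d2ae315ead614bb4)

HONEST FRAMING. OURS (cell res-hironaka, crux chain w45b, slot W4.5(b)); NOT a statement of any manuscript; reporting sentence of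
record «typed door alive-by-theorem n ≤ 4, summit-equivalent n ≥ 5». AI-written, weaker than expert review. No `sorry`; standard axioms.

`EquisingularLiftNat` (EL♮) differs from `EquisingularLift` (EL, stmt-15660) in two ways: the ambient is the FIXED `ℙⁿ_O` with
`Y` the image of `H`, and every blow-up step carries the extra E1 clause «the special-fibre points of the centre lie in the CURRENT
strict transform»: `C.support ∩ (σ' ≫ q)⁻¹{closed point} ⊆ Y'`. The tree's engine for EL(≤ 2)
(`Cruxes.EquisingularLift.StrataSplit.resolveOnePoint_dimOne_dim`, `…isolatedPointDrop_dimOne`: blow up the ambient along a Hensel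
SECTION through a non-regular point of the curve; the total `δ`-invariant drops) ALREADY produces E1 steps: the centre is a section
`≅ Spec O` whose only special-fibre point is the chosen non-regular point `w₁ ∈ S'` (`hCspecial` in that proof). This file re-runs
the first theorem carrying, next to the `P₁`-based `Split.Chain`, an ARBITRARY stage predicate `Ch` over the original base `P`
that is closed under E1 steps (hypothesis `hStep`) and implies `Split.Chain` (hypothesis `hChain`) — so no new definition is
introduced; the stub file instantiates `Ch` with EL♮'s literal induction principle.

* `resolveOnePointNat_dimOne_dim` — E1 version of `resolveOnePoint_dimOne_dim` (one non-regular point of a curve resolved by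
  section blow-ups; returns the `P₁`-chain AND `Ch` at the new stage).
(`isolatedPointDropNat_dimOne`, the E1 version of `isolatedPointDrop_dimOne`, is in the stub file `…NatStubElnatLeTwo`.)

References: the two source modules (proofs copied with the E1 bookkeeping added); Liu 2002 §8.1 (blow-ups along sections),
Kollár 2007 §1.4 (`δ`-drop); L/w45b/CRUX-PLAN.md v3 §2 (line `sections`, first rung).
-/

set_option linter.dupNamespace false -- mandated namespace `Summit.<Summit>.<Problem>` of this single-conjunct summit
set_option linter.overlappingInstances false -- signatures carry `[IsDomain O] [IsDiscreteValuationRing O]`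

noncomputable section

open CategoryTheory AlgebraicGeometry TopologicalSpace Topology
open Literature.AlgebraicGeometry.Resolution
open AlgebraicGeometry.Scheme.IdealSheafData
open Summit.ResolutionOfSingularities.ResolutionOfSingularities.Theses.EquisingularLift.Split
open Summit.ResolutionOfSingularities.ResolutionOfSingularities.Cruxes.EquisingularLift.StrataSplit

namespace Summit.ResolutionOfSingularities.ResolutionOfSingularities.Cruxes.EquisingularLiftNat.Sections

/-- **E1 version of `resolveOnePoint_dimOne_dim`.** Liftable embedded resolution of ONE non-regular point `x₀` of the reduced
strict transform (a curve inside the special fibre) by finitely many blow-ups of the ambient along Hensel SECTIONS; every centre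
meets the special fibre only in a point of the current strict transform, so any stage predicate `Ch` over the original base
`P` that is closed under E1 steps (`hStep`) and implies `Split.Chain` (`hChain`) is propagated from `(P₁, σ₁, S₁)` to the new
stage. Proof = the tree's `resolveOnePoint_dimOne_dim` verbatim (well-founded induction on the total `δ`-invariant), with the
E1 clause discharged by `hCspecial` (the section's unique special-fibre point is the blown-up point `w₁ ∈ S'`).
[folklore; Kollár 2007 §1.4, Liu 2002 §8.1] -/
theorem resolveOnePointNat_dimOne_dim (O : Type) [CommRing O] [IsDomain O] [IsDiscreteValuationRing O] [CharZero O]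
    [IsAdicComplete (IsLocalRing.maximalIdeal O) O] [IsAlgClosed (IsLocalRing.ResidueField O)]
    (P P₁ : Scheme.{0}) (q : P ⟶ Spec (.of O)) (Y : Closeds P)
    (Ch : ∀ X' : Scheme.{0}, (X' ⟶ P) → Set X' → Prop)
    (hChain : ∀ (X' : Scheme.{0}) (σ : X' ⟶ P) (S : Set X'), Ch X' σ S → Chain P (Y : Set P) X' σ S)
    (hStep : ∀ (X' X'' : Scheme.{0}) (σ' : X' ⟶ P) (S' : Set X') (C : X'.IdealSheafData) (τ : X'' ⟶ X'),
      Ch X' σ' S' → IsBlowup τ C → Scheme.IsRegular C.subscheme →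
      σ' '' (C.support : Set X') ⊆ {x : P | ¬ IsGenericPoint x (Y : Set P)} →
      (C.support : Set X') ∩ (σ' ≫ q) ⁻¹' {IsLocalRing.closedPoint O} ⊆ S' →
      Ch X'' (τ ≫ σ') (closure (τ ⁻¹' (S' \ (C.support : Set X')))))
    (σ₁ : P₁ ⟶ P) (S₁ : Set P₁) (hq : Smooth q) (hqp : IsProper q)
    (hY : (Y : Set P) ⊆ q ⁻¹' {IsLocalRing.closedPoint O}) (hYirr : IsIrreducible (Y : Set P))
    (hCh₁ : Ch P₁ σ₁ S₁) (hirr₁ : IsIrreducible ((σ₁ ≫ q) ⁻¹' {IsLocalRing.closedPoint O}))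
    (hgood₁ : GoodSet (σ₁ ≫ q) S₁)
    (hdim : topologicalKrullDim ↥(vanishingIdeal (⟨closure S₁, isClosed_closure⟩ : Closeds P₁)).subscheme ≤ 1)
    (x₀ : ↥(vanishingIdeal (⟨closure S₁, isClosed_closure⟩ : Closeds P₁)).subscheme) (hx₀ : x₀ ∈ singSet S₁) :
    ∃ (P₂ : Scheme.{0}) (σ₂ : P₂ ⟶ P₁) (S₂ : Set P₂),
      topologicalKrullDim ↥(vanishingIdeal (⟨closure S₂, isClosed_closure⟩ : Closeds P₂)).subscheme ≤ 1 ∧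
      Chain P₁ (closure S₁) P₂ σ₂ S₂ ∧ Ch P₂ (σ₂ ≫ σ₁) S₂ ∧
      IsIrreducible (((σ₂ ≫ σ₁) ≫ q) ⁻¹' {IsLocalRing.closedPoint O}) ∧
      ∃ V : P₁.Opens, (∀ x : ↥(vanishingIdeal (⟨closure S₁, isClosed_closure⟩ : Closeds P₁)).subscheme, x ≠ x₀ →
          ((vanishingIdeal (⟨closure S₁, isClosed_closure⟩ : Closeds P₁)).subschemeι x : P₁) ∈ V) ∧ IsIso (σ₂ ∣_ V) ∧
        ∀ z : ↥(vanishingIdeal (⟨closure S₂, isClosed_closure⟩ : Closeds P₂)).subscheme,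
          (σ₂ ((vanishingIdeal (⟨closure S₂, isClosed_closure⟩ : Closeds P₂)).subschemeι z) : P₁) =
            (vanishingIdeal (⟨closure S₁, isClosed_closure⟩ : Closeds P₁)).subschemeι x₀ →
          IsRegularLocalRing ((vanishingIdeal (⟨closure S₂, isClosed_closure⟩ : Closeds P₂)).subscheme.presheaf.stalk z) := by
  classical
  have hch₁ : Chain P (Y : Set P) P₁ σ₁ S₁ := hChain _ _ _ hCh₁
  -- ambient facts
  haveI := hq
  haveI := hqp
  have hPnoeth : IsLocallyNoetherian P := LocallyOfFiniteType.isLocallyNoetherian q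
  have hPreg : Scheme.IsRegular P := fun x => (stub_goodAtOfSmooth O P q hq x).1
  obtain ⟨hP₁noeth, hP₁reg, hσ₁⟩ := chain_isRegular P (Y : Set P) P₁ σ₁ S₁ hch₁ hPnoeth hPreg
  haveI := hP₁noeth
  haveI := hσ₁
  set r₁ : P₁ ⟶ Spec (.of O) := σ₁ ≫ q with hr₁
  haveI : IsProper r₁ := inferInstance
  set s₀ := IsLocalRing.closedPoint O with hs₀def
  -- the closed irreducible set `closure S₁` and its reduced subscheme `Γ₁`
  have hTsub : closure S₁ ⊆ r₁ ⁻¹' {s₀} := closure_subset_preimage_of_chain q hYirr Y.isClosed hY hch₁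
  obtain ⟨ξ, hξ⟩ : ∃ ξ : P, IsGenericPoint ξ (Y : Set P) := QuasiSober.sober hYirr Y.isClosed
  obtain ⟨ξ₁, hfib₁, hS₁⟩ := Chain.fibre hch₁ hξ
  have hTirr : IsIrreducible (closure S₁) := by
    rw [hS₁, closure_closure]; exact isIrreducible_singleton.closure
  have hclS₁ : closure S₁ = S₁ := by rw [hS₁, closure_closure]
  have hgen₁ : IsGenericPoint ξ₁ (closure S₁) := by
    rw [isGenericPoint_def, hS₁, closure_closure]
  haveI hΓ₁int : IsIntegral (vanishingIdeal (⟨closure S₁, isClosed_closure⟩ : Closeds P₁)).subscheme :=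
    ComponentGluing.isIntegral_subscheme_vanishingIdeal _ hTirr
  obtain ⟨p₀, hp₀⟩ : ∃ p₀ : P₁, p₀ = (vanishingIdeal (⟨closure S₁, isClosed_closure⟩ : Closeds P₁)).subschemeι x₀ :=
    ⟨_, rfl⟩
  have hrange₁ : Set.range (vanishingIdeal (⟨closure S₁, isClosed_closure⟩ : Closeds P₁)).subschemeι = closure S₁ := by
    rw [range_subschemeι, coe_support_vanishingIdeal]; rfl
  have hp₀T : p₀ ∈ closure S₁ := by rw [hp₀]; exact (Set.ext_iff.mp hrange₁ _).mp (Set.mem_range_self x₀)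
  have hp₀s : r₁ p₀ = s₀ := hTsub hp₀T
  have hp₀gen : ¬ IsGenericPoint p₀ (closure S₁) := by
    rw [hp₀]
    exact not_isGenericPoint_of_not_isRegularLocalRing (⟨closure S₁, isClosed_closure⟩ : Closeds P₁) hTirr x₀ hx₀
  -- a point of `P₁` off the generic point of `closure S₁` and in the special fibre is off the generic point of `Y`
  have hoffY : ∀ x : P₁, ¬ IsGenericPoint x (closure S₁) → ¬ IsGenericPoint (σ₁ x) (Y : Set P) := by
    intro x hx hgen
    have h1 : σ₁ x = ξ := hgen.eq hξ
    have h2 : x = ξ₁ := by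
      have : x ∈ σ₁ ⁻¹' {ξ} := h1
      rw [hfib₁] at this
      simpa using this
    exact hx (h2 ▸ hgen₁)
  -- THE INDUCTION on the total `δ`-invariant of the current reduced strict transform
  suffices key : ∀ (n : ℕ∞) (X' : Scheme.{0}) (σ' : X' ⟶ P₁) (S' : Set X')
      [IsIntegral (vanishingIdeal (⟨closure S', isClosed_closure⟩ : Closeds X')).subscheme],
      Chain P₁ (closure S₁) X' σ' S' →
      Ch X' (σ' ≫ σ₁) S' →
      IsIrreducible ((σ' ≫ r₁) ⁻¹' {s₀}) →
      (∃ V : P₁.Opens, (∀ x : ↥(vanishingIdeal (⟨closure S₁, isClosed_closure⟩ : Closeds P₁)).subscheme, x ≠ x₀ →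
          ((vanishingIdeal (⟨closure S₁, isClosed_closure⟩ : Closeds P₁)).subschemeι x : P₁) ∈ V) ∧ IsIso (σ' ∣_ V)) →
      (∀ w : X', σ' w = p₀ → GoodAt (σ' ≫ r₁) w) →
      topologicalKrullDim ↥(vanishingIdeal (⟨closure S', isClosed_closure⟩ : Closeds X')).subscheme ≤ 1 →
      ∑ᶠ y : ↥(vanishingIdeal (⟨closure S', isClosed_closure⟩ : Closeds X')).subscheme,
        pointDelta (vanishingIdeal (⟨closure S', isClosed_closure⟩ : Closeds X')).subscheme y = n →
      ∃ (P₂ : Scheme.{0}) (σ₂ : P₂ ⟶ P₁) (S₂ : Set P₂),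
        topologicalKrullDim ↥(vanishingIdeal (⟨closure S₂, isClosed_closure⟩ : Closeds P₂)).subscheme ≤ 1 ∧
        Chain P₁ (closure S₁) P₂ σ₂ S₂ ∧ Ch P₂ (σ₂ ≫ σ₁) S₂ ∧
        IsIrreducible (((σ₂ ≫ σ₁) ≫ q) ⁻¹' {s₀}) ∧
        ∃ V : P₁.Opens, (∀ x : ↥(vanishingIdeal (⟨closure S₁, isClosed_closure⟩ : Closeds P₁)).subscheme, x ≠ x₀ →
          ((vanishingIdeal (⟨closure S₁, isClosed_closure⟩ : Closeds P₁)).subschemeι x : P₁) ∈ V) ∧ IsIso (σ₂ ∣_ V) ∧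
          ∀ z : ↥(vanishingIdeal (⟨closure S₂, isClosed_closure⟩ : Closeds P₂)).subscheme,
            (σ₂ ((vanishingIdeal (⟨closure S₂, isClosed_closure⟩ : Closeds P₂)).subschemeι z) : P₁) = p₀ →
            IsRegularLocalRing ((vanishingIdeal (⟨closure S₂, isClosed_closure⟩ : Closeds P₂)).subscheme.presheaf.stalk z) by
    -- the base stage `(P₁, 𝟙, S₁)`
    have hbase := key _ P₁ (𝟙 P₁) S₁ (fun Q h0 _ => by rwa [hclS₁] at h0)
      (by simpa only [Category.id_comp] using hCh₁)
      (by simpa only [Category.id_comp] using hirr₁)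
      ⟨⊤, fun x _ => trivial, inferInstance⟩
      (fun w hw => by
        have hw' : w = p₀ := by simpa using hw
        rw [Category.id_comp, hw', hp₀]; exact hgood₁ x₀ hx₀) hdim rfl
    simpa only [hp₀] using hbase
  intro n
  induction n using WellFoundedLT.induction with
  | ind n ih =>
  intro X' σ' S' hI' hchain hCh hirr hV hgoodAt hdim' hM
  -- facts about the stage
  obtain ⟨hnoeth', hreg', hpropσ'⟩ := chain_isRegular P₁ (closure S₁) X' σ' S' hchain hP₁noeth hP₁reg
  haveI := hnoeth'
  haveI := hpropσ'
  set r' : X' ⟶ Spec (.of O) := σ' ≫ r₁ with hr'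
  haveI : IsProper r' := inferInstance
  by_cases hbad : ∃ z : ↥(vanishingIdeal (⟨closure S', isClosed_closure⟩ : Closeds X')).subscheme,
      σ' ((vanishingIdeal (⟨closure S', isClosed_closure⟩ : Closeds X')).subschemeι z) = p₀ ∧
      ¬ IsRegularLocalRing ((vanishingIdeal (⟨closure S', isClosed_closure⟩ : Closeds X')).subscheme.presheaf.stalk z)
  swap
  · -- EXIT: no non-regular point over `x₀` is left
    obtain ⟨V, hVx, hiso⟩ := hV
    refine ⟨X', σ', S', hdim', hchain, hCh, by simpa only [Category.assoc] using hirr, V, hVx, hiso, fun z hz => ?_⟩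
    by_contra h
    exact hbad ⟨z, hz, h⟩
  -- STEP: blow up a section through a non-regular point `z₁` over `x₀`
  obtain ⟨z₁, hz₁, hz₁reg⟩ := hbad
  obtain ⟨V, hVx, hiso⟩ := hV
  -- (s1) the stage is integral and flat over `O`
  set w₁ : X' := (vanishingIdeal (⟨closure S', isClosed_closure⟩ : Closeds X')).subschemeι z₁ with hw₁
  have hr'w₁ : r' w₁ = s₀ := by
    show (σ' ≫ r₁) w₁ = s₀
    rw [Scheme.Hom.comp_apply, hz₁, hp₀s]
  have hga : GoodAt r' w₁ := hgoodAt w₁ hz₁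
  obtain ⟨hint', hflat', -⟩ := isIntegral_and_flat_of_goodAt O X' r' hnoeth' hreg' hirr ⟨w₁, hr'w₁, hga⟩
  haveI := hint'
  -- (s2) a smooth neighbourhood of `w₁`
  haveI : LocallyOfFinitePresentation r' := locallyOfFinitePresentation_of_isLocallyNoetherian' r'
  obtain ⟨U, hw₁U, hU⟩ := exists_smooth_nhd_of_goodAt O X' r' inferInstance hflat' w₁ hr'w₁ hga
  -- (s3) `S'` is closed irreducible inside the special fibre; `w₁` is a closed point
  obtain ⟨ξT, hξT⟩ : ∃ ξT : P₁, IsGenericPoint ξT (closure S₁) := QuasiSober.sober hTirr isClosed_closure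
  obtain ⟨ξ', hfib', hS'⟩ := Chain.fibre hchain hξT
  have hS'cl : IsClosed S' := by rw [hS']; exact isClosed_closure
  have hclS' : closure S' = S' := hS'cl.closure_eq
  have hS'irr : IsIrreducible (closure S') := by
    rw [hS', closure_closure]; exact isIrreducible_singleton.closure
  have hS'sub : closure S' ⊆ r' ⁻¹' {s₀} :=
    closure_subset_preimage_of_chain r₁ hTirr isClosed_closure hTsub hchain
  have hrange' : Set.range (vanishingIdeal (⟨closure S', isClosed_closure⟩ : Closeds X')).subschemeι = closure S' := by
    rw [range_subschemeι, coe_support_vanishingIdeal]; rfl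
  have hw₁mem : w₁ ∈ closure S' := (Set.ext_iff.mp hrange' _).mp (Set.mem_range_self z₁)
  have hw₁gen : ¬ IsGenericPoint w₁ (closure S') :=
    not_isGenericPoint_of_not_isRegularLocalRing (⟨closure S', isClosed_closure⟩ : Closeds X') hS'irr z₁ hz₁reg
  haveI : CompactSpace X' := QuasiCompact.compactSpace_of_compactSpace r'
  haveI : IsNoetherian X' := ⟨⟩
  haveI : IsNoetherian (vanishingIdeal (⟨closure S', isClosed_closure⟩ : Closeds X')).subscheme :=
    isNoetherian_of_isClosedImmersion (vanishingIdeal (⟨closure S', isClosed_closure⟩ : Closeds X')).subschemeι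
  have hqe' : Scheme.IsQuasiExcellent (vanishingIdeal (⟨closure S', isClosed_closure⟩ : Closeds X')).subscheme := by
    haveI : IsReduced (vanishingIdeal (⟨closure S', isClosed_closure⟩ : Closeds X')).subscheme := inferInstance
    refine isQuasiExcellent_of_range_subset_closedPoint
      ((vanishingIdeal (⟨closure S', isClosed_closure⟩ : Closeds X')).subschemeι ≫ r') ?_
    rintro _ ⟨y, rfl⟩
    rw [Scheme.Hom.comp_apply]
    exact hS'sub ((Set.ext_iff.mp hrange' _).mp (Set.mem_range_self y))
  have hz₁cl : IsClosed ({z₁} : Set (vanishingIdeal (⟨closure S', isClosed_closure⟩ : Closeds X')).subscheme) :=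
    isClosed_singleton_of_not_isRegularLocalRing hqe' hdim' z₁ hz₁reg
  have hw₁cl : IsClosed ({w₁} : Set X') := by
    have h := (vanishingIdeal (⟨closure S', isClosed_closure⟩ : Closeds X')).subschemeι.isClosedEmbedding.isClosedMap
      _ hz₁cl
    rwa [Set.image_singleton] at h
  -- (s4) a `κ`-point at `w₁` and a section through it (Hensel)
  obtain ⟨xpt, hxr, hxrange⟩ := exists_point_of_isClosed O X' r' inferInstance w₁ hw₁cl hr'w₁
  obtain ⟨s, hs, hsx⟩ := exists_section_of_smooth O X' r' U hU xpt
    (by rw [hxrange]; exact Set.singleton_subset_iff.mpr hw₁U) hxr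
  have hs₀ : s s₀ = w₁ := by
    haveI : IsLocalHom (CommRingCat.ofHom (IsLocalRing.residue O)).hom :=
      inferInstanceAs (IsLocalHom (IsLocalRing.residue O))
    have h1 : Spec.map (CommRingCat.ofHom (IsLocalRing.residue O))
        (IsLocalRing.closedPoint (IsLocalRing.ResidueField O)) = s₀ := AlgebraicGeometry.Spec_closedPoint
    have h2 : s s₀ = xpt (IsLocalRing.closedPoint (IsLocalRing.ResidueField O)) := by
      rw [← h1, ← Scheme.Hom.comp_apply, hsx]
    rw [h2]
    exact (Set.ext_iff.mp hxrange _).mp (Set.mem_range_self _)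
  have hsU : s s₀ ∈ U := hs₀ ▸ hw₁U
  -- points of the section: `r' (s t) = t`
  have hrs : ∀ t : Spec (.of O), r' (s t) = t := fun t => by
    rw [← Scheme.Hom.comp_apply, hs]; rfl
  -- (s5) the centre `C = s.ker`
  obtain ⟨_, hCreg, -, hCsupp⟩ := section_isClosedImmersion_and_isRegular_ker O X' r' s hs
  have hCspecial : ∀ c ∈ (s.ker.support : Set X'), r' c = s₀ → c = w₁ := by
    intro c hc hcs
    rw [hCsupp] at hc
    obtain ⟨t, rfl⟩ := hc
    rw [hrs] at hcs
    rw [hcs, hs₀]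
  have hξ'mem : ξ' ∈ closure S' := by rw [hS', closure_closure]; exact subset_closure rfl
  have hξ'gen : IsGenericPoint ξ' (closure S') := by
    rw [isGenericPoint_def, hS', closure_closure]
  have hξ'C : ξ' ∉ (s.ker.support : Set X') := fun h =>
    hw₁gen (hCspecial ξ' h (hS'sub hξ'mem) ▸ hξ'gen)
  have hCne : s.ker ≠ ⊥ := by
    intro h
    apply hξ'C
    rw [h, Scheme.IdealSheafData.support_bot]
    trivial
  have hnotsub : ¬ closure S' ⊆ (s.ker.support : Set X') := fun h => hξ'C (h hξ'mem)
  -- (s6) blow up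
  obtain ⟨X'', τ, hτ⟩ := exists_isBlowup X' s.ker
  haveI : IsProper τ := hτ.isProper
  have hnoeth'' : IsLocallyNoetherian X'' := LocallyOfFiniteType.isLocallyNoetherian τ
  -- (s7) the extended chains: the `P₁`-chain, and the E1 predicate `Ch` over `P`
  have hT : σ' '' (s.ker.support : Set X') ⊆ {x : P₁ | ¬ IsGenericPoint x (closure S₁)} := by
    rintro _ ⟨c, hc, rfl⟩ hgen
    have hcs : r' c = s₀ := by
      show (σ' ≫ r₁) c = s₀
      rw [Scheme.Hom.comp_apply]
      exact hTsub hgen.mem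
    have hc' := hCspecial c hc hcs
    rw [hc', hz₁] at hgen
    exact hp₀gen hgen
  have hchain'' : Chain P₁ (closure S₁) X'' (τ ≫ σ') (closure (τ ⁻¹' (S' \ (s.ker.support : Set X')))) :=
    fun Q h0 hstep => hstep X' X'' σ' S' s.ker τ (hchain Q h0 hstep) hτ hCreg hT
  have hTY : (σ' ≫ σ₁) '' (s.ker.support : Set X') ⊆ {x : P | ¬ IsGenericPoint x (Y : Set P)} := by
    rintro _ ⟨c, hc, rfl⟩
    rw [Scheme.Hom.comp_apply]
    exact hoffY (σ' c) (hT ⟨c, hc, rfl⟩)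
  have hE1 : (s.ker.support : Set X') ∩ ((σ' ≫ σ₁) ≫ q) ⁻¹' {s₀} ⊆ S' := by
    rintro c ⟨hc, hcs⟩
    have hcs' : r' c = s₀ := by
      show (σ' ≫ (σ₁ ≫ q)) c = s₀
      rw [← Category.assoc]
      exact hcs
    rw [hCspecial c hc hcs', ← hclS']
    exact hw₁mem
  have hCh'' : Ch X'' ((τ ≫ σ') ≫ σ₁) (closure (τ ⁻¹' (S' \ (s.ker.support : Set X')))) := by
    rw [Category.assoc]
    exact hStep X' X'' (σ' ≫ σ₁) S' s.ker τ hCh hτ hCreg hTY hE1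
  -- (s8) the special fibre stays irreducible
  have hirr'' : IsIrreducible (((τ ≫ σ') ≫ r₁) ⁻¹' {s₀}) := by
    rw [Category.assoc]
    exact isIrreducible_specialFibre_of_isBlowup_section O X' X'' r' U hU s hs hsU hCne τ hτ hirr
  -- (s9) the open `V''` over which the new chain is an isomorphism
  have hclosed : IsClosed (σ' '' (s.ker.support : Set X')) := σ'.isClosedMap _ s.ker.support.isClosed
  let V'' : P₁.Opens := V ⊓ ⟨(σ' '' (s.ker.support : Set X'))ᶜ, hclosed.isOpen_compl⟩
  have hV''V : V'' ≤ V := inf_le_left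
  have hV''x : ∀ x : ↥(vanishingIdeal (⟨closure S₁, isClosed_closure⟩ : Closeds P₁)).subscheme, x ≠ x₀ →
      ((vanishingIdeal (⟨closure S₁, isClosed_closure⟩ : Closeds P₁)).subschemeι x : P₁) ∈ V'' := by
    intro x hx
    refine ⟨hVx x hx, ?_⟩
    rintro ⟨c, hc, hce⟩
    have hxT : ((vanishingIdeal (⟨closure S₁, isClosed_closure⟩ : Closeds P₁)).subschemeι x : P₁) ∈ closure S₁ :=
      (Set.ext_iff.mp hrange₁ _).mp (Set.mem_range_self x)
    have hcs : r' c = s₀ := by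
      show (σ' ≫ r₁) c = s₀
      rw [Scheme.Hom.comp_apply, hce]
      exact hTsub hxT
    have hc' := hCspecial c hc hcs
    rw [hc', hz₁, hp₀] at hce
    exact hx ((vanishingIdeal (⟨closure S₁, isClosed_closure⟩ : Closeds P₁)).subschemeι.isClosedEmbedding.injective
      hce).symm
  let Wc : X'.Opens := ⟨(s.ker.support : Set X')ᶜ, s.ker.support.isClosed.isOpen_compl⟩
  have hWc : IsIso (τ ∣_ Wc) := hτ.isIso_morphismRestrict disjoint_compl_left
  have hle : (Opens.map σ'.base).obj V'' ≤ Wc := fun x hx hxC => hx.2 ⟨x, hxC, rfl⟩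
  have hiso'' : IsIso ((τ ≫ σ') ∣_ V'') := by
    rw [morphismRestrict_comp]
    have i1 := isIso_morphismRestrict_of_le σ' hiso hV''V
    have i2 := isIso_morphismRestrict_of_le τ hWc hle
    exact @IsIso.comp_isIso _ _ _ _ _ _ _ i2 i1
  -- (s10) good reduction at every point over `x₀`
  have hgoodAt'' : ∀ w : X'', (τ ≫ σ') w = p₀ → GoodAt ((τ ≫ σ') ≫ r₁) w := by
    intro w hw
    rw [Scheme.Hom.comp_apply] at hw
    rw [Category.assoc]
    by_cases hC : τ w ∈ (s.ker.support : Set X')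
    · have hcs : r' (τ w) = s₀ := by
        show (σ' ≫ r₁) (τ w) = s₀
        rw [Scheme.Hom.comp_apply, hw, hp₀s]
      have hc' : τ w = s s₀ := (hCspecial _ hC hcs).trans hs₀.symm
      exact goodAt_of_isBlowup_section O X' X'' r' U hU s hs hsU τ hτ w hc'
    · exact (stub_goodAtOverIso X' X'' τ Wc hWc w (τ w) rfl hC O r').mpr (hgoodAt (τ w) hw)
  -- (s11) the new reduced strict transform is the point blow-up of the curve: `dim ≤ 1` and the total `δ` drops
  set S'' : Set X'' := closure (τ ⁻¹' (S' \ (s.ker.support : Set X'))) with hS''def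
  obtain ⟨ξ'', -, hS''⟩ := Chain.fibre hchain'' hξT
  have hS''cl : closure S'' = S'' := by rw [hS'', closure_closure]
  have hS''irr : IsIrreducible (closure S'') := by
    rw [hS'', closure_closure]; exact isIrreducible_singleton.closure
  haveI hI'' : IsIntegral (vanishingIdeal (⟨closure S'', isClosed_closure⟩ : Closeds X'')).subscheme :=
    ComponentGluing.isIntegral_subscheme_vanishingIdeal _ hS''irr
  have e1 : closure (τ ⁻¹' (closure S' \ (s.ker.support : Set X'))) = closure S'' := by
    rw [hclS', hS''cl]
  have e2 : (⟨closure (τ ⁻¹' (closure S' \ (s.ker.support : Set X'))), isClosed_closure⟩ : Closeds X'') =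
      ⟨closure S'', isClosed_closure⟩ := TopologicalSpace.Closeds.ext e1
  have L : ∀ [IsIntegral (vanishingIdeal (⟨closure (τ ⁻¹' (closure S' \ (s.ker.support : Set X'))),
      isClosed_closure⟩ : Closeds X'')).subscheme],
      topologicalKrullDim ↥(vanishingIdeal (⟨closure (τ ⁻¹' (closure S' \ (s.ker.support : Set X'))),
        isClosed_closure⟩ : Closeds X'')).subscheme ≤ 1 ∧
      ∑ᶠ y : ↥(vanishingIdeal (⟨closure (τ ⁻¹' (closure S' \ (s.ker.support : Set X'))),
          isClosed_closure⟩ : Closeds X'')).subscheme,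
        pointDelta (vanishingIdeal (⟨closure (τ ⁻¹' (closure S' \ (s.ker.support : Set X'))),
          isClosed_closure⟩ : Closeds X'')).subscheme y <
      ∑ᶠ y : ↥(vanishingIdeal (⟨closure S', isClosed_closure⟩ : Closeds X')).subscheme,
        pointDelta (vanishingIdeal (⟨closure S', isClosed_closure⟩ : Closeds X')).subscheme y := by
    intro hinst
    have h := curveBlowup_of_isBlowup_section O X' X'' r' s hs τ hτ (closure S') isClosed_closure hS'irr hS'sub
      hnotsub z₁ hs₀.symm hz₁reg hdim'
    exact ⟨h.1, h.2.2.2.2.2⟩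
  rw [e2] at L
  obtain ⟨hdim'', hlt⟩ := L
  -- (s12) induction hypothesis
  rw [hM] at hlt
  exact ih _ hlt X'' (τ ≫ σ') S'' hchain'' hCh'' hirr'' ⟨V'', hV''x, hiso''⟩ hgoodAt'' hdim'' rfl


end Summit.ResolutionOfSingularities.ResolutionOfSingularities.Cruxes.EquisingularLiftNat.Sections

end
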